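import Summits.QuantumFields.BalabanUV.T4Continuum.Support.NE7HintOfLocalChartSU2Wide
import Summits.QuantumFields.BalabanUV.T4Continuum.Support.NE7CubeChartTorus
import HarnessLib

/-!
# NE7 — (8)∃ FROM THE PRINTED FIRST-ORDER CHART OF [B11] Thm 1 (9) ON CUBES, SU(2)∕U(2) on T⁴, `L = 2` (F298): around every point `z` a unitary gauge `u₀`
# and a potential `A₀` with `U^{u₀} = e^{A₀}`, `A₀` skew, `‖A₀‖ ≤ c₀t∕M`, `‖∇A₀‖ ≤ c₁t∕M²` on the sup-cube of radius `(nbRad + 2ℓ + 11)·M` (`t = r + 4(e^β − 1) + ε`,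
# `c₀, c₁ ≤ A(ℓ+1)^p`) ⟹ `hchart` of F286w (F297) ⟹ (8)∃

Cell `pub-balaban`, rung (B)+1 sub-cell t4, lineage `b2b-balaban-t4-ne7-p1` (CRUX PROVER NE7 #1 = OWNER of row NE7), generation 92; memo
`t4/b2b-balaban-t4-ne7-p1-g92/LOG-OBSTRUCTION.md`.  Over F286w `NE7HintOfLocalChartSU2Wide.hint_of_localChart_SU2_wide` ((8)∃ ⇐ hchart ∧ hleaves ∧ lines on the
wide cover) and F297 `NE7CubeChartTorus.exists_periodic_chart_of_cubeChart` (cube chart ⟹ periodic chart).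

WHY.  THE END OF RECORD OF ROW NE7 REVERTS TO THE FIRST-ORDER CHART.  Gen 91 reduced F286w's chart binder to the covariant plaquette-gradient radius `x₁ ≤ C_g·t∕M³`
((PG), F291) and to local second-difference letters `‖∇∇A‖ ≤ c₂t∕M³` ((REG9), F295), both with `k`-UNIFORM constants.  Those are NOT what [Balaban1985Variational]
Thm 1 prints — (9) bounds `‖A‖_{1,β}` for `β ≤ β₀` with `B₄(β₀)` depending on `β₀`, (10) only `|∂*∂A|`, `|ΔA|`; [Balaban1985RegularSpaces] p. 83: «Such information
is unavailable for the second order derivatives» — and they FAIL by a factor `log M = (k+1) log 2` for generic data: the constraint current `j = Q*λ` of the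
minimiser is block-column-wise constant with jumps across block faces, and at a codimension-2 block edge the mixed second difference of the lattice potential
`Δ⁻¹j` is `(mixed jump)·(log M)∕(2π) + O(1)` (memo §1–§2; lattice computation job j326303: the corner value steps by `0.1104 = log 2∕(2π)` per doubling, n = 31 … 2047).
The FIRST-ORDER letters `|A| ≲ M_c·t∕M`, `|∇A| ≲ M_c·t∕M²` on a cube of `M_c` blocks ARE (9)'s first two clauses verbatim (one derivative of the potential of a
bounded source carries no logarithm), and they are all F286w consumes.  This file therefore states the NE7-specific input of route 1's END in exactly that printed,
LOCAL, first-order form — a cube chart about every point — and discharges the torus plumbing (periodic gauge, periodic field, global letters) by F297.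
WHAT ([folklore] composition + arithmetic; 0 def, 0 sorry).  §1 `chart_of_cubeChart_SU2`: (CUBE) with letters `c₀, c₁` on the `Kc`-fold cover, `Kc ≥ 4ℓ + 64` ⟹
`hchart` of F286w with `C₀ = c₀`, `C₁ = c₀ + c₁` (cube radius `R′ = (nbRad+2ℓ+11)M`, collar `M`, ball `(nbRad+2ℓ+10)M`; `2R′ + 4 ≤ N·Kc·M`).  §2 **`hint_of_cubeChart_SU2`**:
∀ `A ≥ 0`, `p` ∃ `ℓ ≥ 1`, `ε₀ > 0` ∀ `0 < ε ≤ ε₀` ∃ `β₀ > 0` ∀ `0 < β ≤ β₀` ∀ `N ≥ 1` ∀ `c₀, c₁ ∈ [0, A(ℓ+1)^p]`: route Π's two lines ∧ (CUBE on the `(4ℓ+64)`-fold cover)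
∧ hleaves ⟹ (8)∃.
HONEST FRAMING (page 1): (CUBE) is [B11] Thm 1 (9) TYPE (first-order letters, local), asserted for nothing; hleaves ([B11] Prop 2 TYPE) likewise; nothing of Bałaban's
asserted as an axiom; NE7 NOT PROVED unconditionally; spine 0∕9; finite T⁴ rung (B)+1 — NOT infinite volume, NOT mass gap, NOT `BetaPertH`, NOT Clay.  Continuum YM
on T⁴ ⇐ BetaPertH ∧ nine spine estimates (0/9 proved); BetaPertH ⇐ (D1) ∧ (D4) ∧ CAP+tail; G-an2-4 gates asym, D1 and NE2/3/4.  No `sorry`; axioms ⊆ {propext,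
Classical.choice, Quot.sound}.
-/

set_option autoImplicit false

open scoped BigOperators Matrix Matrix.Norms.L2Operator Topology
open NormedSpace Finset Set Filter

namespace Summit.QuantumFields.BalabanUV.T4Continuum.NE7HintOfCubeChartSU2

open Literature.MathematicalPhysics.QuantumFieldTheory.Balaban1983to89
open B7Prop1Explicit B7Prop2Explicit MatrixLog UnitaryModel
open B4TorusKernel.MultiPeriod (torusSupNorm)
open T4AveragingDeficitWall (Ad IsUnitaryCfg IsSkewDir SmallField vary curl curlSq dirSq dirL1)
open T4AveragingDeficitWallBoundary (IsPeriodicCfg periodBox)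
open AveragingDeficitPeriodicCounting (IsPeriodicDir)
open AveragingDeficitMultiLevelPrep (LevelSmall tower TangentIter)
open BlockAverageVaryHolo (nbRad)
open MinimalActionLevels (perWin)
open MinimalActionSandwich (IsMinimiser admissible)
open MinimalActionRate (sfClass)
open NE3HessForm (dAction)
open NE3SlicePoincareBudgetLine (CPLine)
open NE3TangentCovariantTower (dirIter)
open NE3DecomposedRepOfLinearNormalPart (ResidualSliceRepT)
open NE3QbarIterCovLiftPrep (cruxC)
open NE3SmoothRightInverseW (rightInvW)
open NE3RightInverseSolveLetters (thetaLoc)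
open NE3RightInverseL2Letter (l2C)
open NE3HatInvCurlLetters (curl2C curl1C)
open NE3EnergyShapes (IsUnitarySite)
open BlockAveragePushDirSplit (flat)
open NE7HintOfLocalChartSU2Wide (hint_of_localChart_SU2_wide)
open NE7CubeChartTorus (exists_periodic_chart_of_cubeChart)

noncomputable section

variable {n : Type*} [Fintype n] [DecidableEq n]

/-! ## §1 The `hchart` binder of F286w from a cube chart about every point -/

set_option maxHeartbeats 800000 in
/-- **THE PERIODIC CHART OF ROW NE7 FROM THE PRINTED CUBE CHART, SU(2)∕U(2) on T⁴, `L = 2`.**  For `ℓ`, `N ≥ 1`, a cover factor `Kc ≥ 4ℓ + 64`, `ε, β, c₀, c₁ ≥ 0`: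
IF every tangent-critical admissible `U` of the class (period `N·Kc·2^{k+1}`) with `SmallField U (r∕M²)`, `0 ≤ r ≤ ε∕4`, admits about every point `z` a unitary
site gauge `u₀` and a potential `A₀` with `U^{u₀} = e^{A₀}`, `A₀` skew, `‖A₀‖ ≤ c₀t∕M`, `‖∇A₀‖ ≤ c₁t∕M²` on the sup-cube of radius `(nbRad 4 2 + 2ℓ + 11)·M` about `z`
([Balaban1985Variational] Thm 1 (9), first-order letters, TYPE), THEN the `hchart` binder of F286w holds with `C₀ = c₀`, `C₁ = c₀ + c₁` (F297: cut-off over a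
collar `M`, centred representative). [folklore] -/
theorem chart_of_cubeChart_SU2 (ℓ : ℕ) {N : ℕ} [NeZero N] (hN : 1 ≤ N) {Kc : ℕ} (hKc : 4 * ℓ + 64 ≤ Kc) {ε β c₀ c₁ : ℝ} (hε0 : 0 ≤ ε)
    (hβ0 : 0 ≤ β) (hc₀ : 0 ≤ c₀) (hc₁ : 0 ≤ c₁)
    (hcube : (∀ D : Site 4 → Fin 4 → (Matrix n n ℂ)ˣ, IsUnitaryCfg D → IsPeriodicCfg D ((N * Kc) : ℤ) → SmallField D (4 * (Real.exp β - 1)) →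
      ∀ (k : ℕ), ∀ U ∈ admissible (sfClass 4 2 (N * Kc) ε) 2 (k + 1) D,
      (∀ φ : Site 4 → Fin 4 → Matrix n n ℂ, IsSkewDir φ → IsPeriodicDir φ (((N * Kc) * 2 ^ (k + 1) : ℕ) : ℤ) → TangentIter 2 k U φ →
        dAction U φ (perWin 4 ((N * Kc) * 2 ^ (k + 1))) = 0) →
      ∀ r : ℝ, 0 ≤ r → r ≤ (1 / ((2 : ℕ) : ℝ) ^ 2 * ε) → SmallField U (r / (((2 : ℕ) : ℝ) ^ (k + 1)) ^ 2) →
      ∀ z : Site 4, ∃ (u₀ : Site 4 → (Matrix n n ℂ)ˣ) (A₀ : Site 4 → Fin 4 → Matrix n n ℂ), IsUnitarySite u₀ ∧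
        (∀ (p : Site 4) (μ : Fin 4), (∀ i, |p i - z i| ≤ (((nbRad 4 2 + 2 * ℓ + 11) * 2 ^ (k + 1) : ℕ) : ℤ)) → gaugeAct u₀ U p μ = expUnit (A₀ p μ)) ∧
        (∀ (p : Site 4) (μ : Fin 4), (∀ i, |p i - z i| ≤ (((nbRad 4 2 + 2 * ℓ + 11) * 2 ^ (k + 1) : ℕ) : ℤ)) → A₀ p μ ∈ skewAdjoint (Matrix n n ℂ)) ∧
        (∀ (p : Site 4) (μ : Fin 4), (∀ i, |p i - z i| ≤ (((nbRad 4 2 + 2 * ℓ + 11) * 2 ^ (k + 1) : ℕ) : ℤ)) →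
          ‖A₀ p μ‖ ≤ c₀ * (r + 4 * (Real.exp β - 1) + ε) / ((2 : ℕ) : ℝ) ^ (k + 1)) ∧
        (∀ (p : Site 4) (μ τ : Fin 4), (∀ i, |p i - z i| ≤ (((nbRad 4 2 + 2 * ℓ + 11) * 2 ^ (k + 1) : ℕ) : ℤ)) →
          (∀ i, |(p + e τ) i - z i| ≤ (((nbRad 4 2 + 2 * ℓ + 11) * 2 ^ (k + 1) : ℕ) : ℤ)) →
          ‖A₀ (p + e τ) μ - A₀ p μ‖ ≤ c₁ * (r + 4 * (Real.exp β - 1) + ε) / (((2 : ℕ) : ℝ) ^ (k + 1)) ^ 2))) :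
    (∀ D : Site 4 → Fin 4 → (Matrix n n ℂ)ˣ, IsUnitaryCfg D → IsPeriodicCfg D ((N * Kc) : ℤ) → SmallField D (4 * (Real.exp β - 1)) →
      ∀ (k : ℕ), ∀ U ∈ admissible (sfClass 4 2 (N * Kc) ε) 2 (k + 1) D,
      (∀ φ : Site 4 → Fin 4 → Matrix n n ℂ, IsSkewDir φ → IsPeriodicDir φ (((N * Kc) * 2 ^ (k + 1) : ℕ) : ℤ) → TangentIter 2 k U φ →
        dAction U φ (perWin 4 ((N * Kc) * 2 ^ (k + 1))) = 0) →
      ∀ r : ℝ, 0 ≤ r → r ≤ (1 / ((2 : ℕ) : ℝ) ^ 2 * ε) → SmallField U (r / (((2 : ℕ) : ℝ) ^ (k + 1)) ^ 2) →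
      ∀ z : Site 4, ∃ (u : Site 4 → (Matrix n n ℂ)ˣ) (At : Site 4 → Fin 4 → Matrix n n ℂ) (a₀ a₁ : ℝ),
        IsUnitarySite u ∧ (∀ (y : Site 4) (i : Fin 4), u (y + (((N * Kc) * 2 ^ (k + 1) : ℕ) : ℤ) • e i) = u y) ∧
        IsSkewDir At ∧ IsPeriodicDir At (((N * Kc) * 2 ^ (k + 1) : ℕ) : ℤ) ∧ 0 ≤ a₀ ∧ 0 ≤ a₁ ∧
        (∀ (y : Site 4) (κ : Fin 4), ‖At y κ‖ ≤ a₀) ∧ (∀ (y : Site 4) (κ τ : Fin 4), ‖At (y + e τ) κ - At y κ‖ ≤ a₁) ∧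
        ((2 : ℕ) : ℝ) ^ (k + 1) * a₀ ≤ c₀ * (r + 4 * (Real.exp β - 1) + ε) ∧ (((2 : ℕ) : ℝ) ^ (k + 1)) ^ 2 * a₁ ≤ (c₀ + c₁) * (r + 4 * (Real.exp β - 1) + ε) ∧
        (∀ (y : Site 4) (κ : Fin 4),
          torusSupNorm (fun _ : Fin 4 => 2 ^ (k + 1) * (N * Kc)) (y - z) ≤ (((nbRad 4 2 + 2 * ℓ + 10) * 2 ^ (k + 1) : ℕ) : ℝ) →
            gaugeAct u U y κ = vary (flat (d := 4) (n := n)) At 1 y κ)) := by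
  intro D hDu hDP hDs k U hU hcrit r hr0 hr hUr z
  obtain ⟨u₀, A₀, hu₀, hUA, hskew, hA0, hA1⟩ := hcube D hDu hDP hDs k U hU hcrit r hr0 hr hUr z
  clear hcube
  -- the block size `M = 2^{k+1}` (generalised), the radii, the period `N·Kc·M`
  have hM2 : 2 ≤ 2 ^ (k + 1) :=
    calc 2 = 2 ^ 1 := by norm_num
      _ ≤ 2 ^ (k + 1) := Nat.pow_le_pow_right (by norm_num) (by omega)
  have hMr' : ((2 : ℕ) : ℝ) ^ (k + 1) = ((2 ^ (k + 1) : ℕ) : ℝ) := by rw [Nat.cast_pow]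
  rw [hMr'] at hA0 hA1 ⊢
  generalize hMdef : 2 ^ (k + 1) = M at *
  have hM1 : 1 ≤ M := by omega
  have hMr : (2 : ℝ) ≤ (M : ℝ) := by exact_mod_cast hM2
  have hM0r : (0 : ℝ) < (M : ℝ) := by linarith
  -- the class data of `U`
  have hUP : IsPeriodicCfg U ((N * Kc * M : ℕ) : ℤ) := by rw [← hMdef]; exact hU.1.2.1
  -- the datum `t`
  have hβ' : 0 ≤ 4 * (Real.exp β - 1) := by nlinarith [Real.add_one_le_exp β]
  have hT0 : 0 ≤ r + 4 * (Real.exp β - 1) + ε := by linarith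
  have hb₀ : 0 ≤ c₀ * (r + 4 * (Real.exp β - 1) + ε) / (M : ℝ) := by positivity
  have hb₁ : 0 ≤ c₁ * (r + 4 * (Real.exp β - 1) + ε) / (M : ℝ) ^ 2 := by positivity
  -- the geometric conditions of F297 (`nbRad 4 2 = 20`)
  have hnb : nbRad 4 2 = 20 := by unfold BlockAverageVaryHolo.nbRad; norm_num
  have hMwR : M ≤ (nbRad 4 2 + 2 * ℓ + 11) * M := by rw [hnb]; nlinarith
  have hPR : 2 * ((nbRad 4 2 + 2 * ℓ + 11) * M) + 4 ≤ N * Kc * M := by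
    rw [hnb]
    have h1 : 4 * ℓ + 64 ≤ N * Kc := hKc.trans (Nat.le_mul_of_pos_left _ (by omega))
    have h2 : (4 * ℓ + 64) * M ≤ N * Kc * M := Nat.mul_le_mul_right _ h1
    nlinarith
  -- F297
  obtain ⟨u, At, huU, huP, hAs, hAP, hsup, hgr, hagree⟩ :=
    exists_periodic_chart_of_cubeChart (d := 3) (n := n) hUP z ((nbRad 4 2 + 2 * ℓ + 11) * M) M hM1 hMwR hPR hu₀ hb₀ hb₁ hUA hskew hA0 hA1
  refine ⟨u, At, _, _, huU, huP, hAs, hAP, hb₀, ?_, hsup, hgr, ?_, ?_, ?_⟩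
  · positivity
  · -- `M·a₀ ≤ c₀·t`
    rw [show (M : ℝ) * (c₀ * (r + 4 * (Real.exp β - 1) + ε) / (M : ℝ)) = c₀ * (r + 4 * (Real.exp β - 1) + ε) by field_simp]
  · -- `M²·a₁ ≤ (c₀ + c₁)·t`
    rw [show (M : ℝ) ^ 2 * (c₁ * (r + 4 * (Real.exp β - 1) + ε) / (M : ℝ) ^ 2 + c₀ * (r + 4 * (Real.exp β - 1) + ε) / (M : ℝ) / (M : ℝ))
      = (c₀ + c₁) * (r + 4 * (Real.exp β - 1) + ε) by field_simp; ring]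
  · -- agreement on the ball of radius `(nbRad 4 2 + 2ℓ + 10)·M`
    intro y κ hy
    apply hagree y κ
    have e2 : (nbRad 4 2 + 2 * ℓ + 11) * M - M = (nbRad 4 2 + 2 * ℓ + 10) * M := by
      apply Nat.sub_eq_of_eq_add
      ring
    rw [e2]
    convert hy using 2
    funext i
    ring

/-! ## §2 (8)∃ from the printed cube chart -/

set_option maxHeartbeats 800000 in
/-- **F298 — (8)∃ FROM THE PRINTED FIRST-ORDER CHART OF [B11] Thm 1 (9) ON CUBES, SU(2)∕U(2) on T⁴, `L = 2`.**  [Balaban1985Variational] Thm 1 (8) ∘ Prop 8 ∘ (9)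
first-order TYPE, rows NE7 ∘ NE3, `card n = 2`: for all `A ≥ 0` and `p` there are `ℓ ≥ 1`, `ε₀ > 0` and, for every `0 < ε ≤ ε₀`, a `β₀ > 0` such that for `0 < β ≤ β₀`,
every period `N ≥ 1` and all `c₀, c₁ ∈ [0, A(ℓ+1)^p]`: IF route Π's two `k`-free lines (letters `C₂, αh, Ch, νh, κh`), the CUBE CHART (around every point `z` of
every tangent-critical admissible configuration on the `(4ℓ+64)`-fold cover with small field `r ≤ ε∕4`: a unitary gauge `u₀` and a skew `A₀` with `U^{u₀} = e^{A₀}`,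
`‖A₀‖ ≤ c₀t∕M`, `‖∇A₀‖ ≤ c₁t∕M²` on the sup-cube of radius `(nbRad 4 2 + 2ℓ + 11)·M`), and row NE3's `hleaves` (at `δ₁ = ε∕8`) hold, THEN for some `δ_V > 0`, over
`{V | unitary, N-periodic, SmallField V δ_V}`, at every level some constrained minimiser over `sfClass 4 2 N ε` is `SmallField U a` with `0 ≤ a < ε∕(2^k)²`.  The
torus plumbing of THE CHART is discharged (§1); NE7 is NOT proved unconditionally ((CUBE), `hleaves` and the two lines remain). -/
theorem hint_of_cubeChart_SU2 [Nonempty n] (hn : Fintype.card n = 2) {A : ℝ} (hA : 0 ≤ A) (p : ℕ) :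
    ∃ ℓ : ℕ, 1 ≤ ℓ ∧ ∃ ε₀ : ℝ, 0 < ε₀ ∧ ∀ ε : ℝ, 0 < ε → ε ≤ ε₀ → ∃ β₀ : ℝ, 0 < β₀ ∧ ∀ β : ℝ, 0 < β → β ≤ β₀ →
    ∀ (N : ℕ) [NeZero N] (C₂ αh Ch νh κh c₀ c₁ : ℝ), 1 ≤ N →
    0 ≤ C₂ → 0 ≤ αh → αh ≤ 1 → 0 ≤ Ch →
    νh = 2 * Real.sqrt (l2C 4 2 / (1 - thetaLoc 4 2 * ε) ^ 2 + curl2C 4 2 / (1 - thetaLoc 4 2 * ε) ^ 2) * C₂ * Ch * αh →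
    κh = 4 * (curl1C 4 2 / (1 - thetaLoc 4 2 * ε)) * C₂ * Ch ^ 2 * ε →
    νh < 1 →
    2 * (κh / (1 - νh) ^ 2) < ((((1 / 2 - (νh / (1 - νh)) ^ 2) / (2 * (1 + (CPLine 4 2 2 (1 / 10 ^ 17) (1 / 10 ^ 53) + 1))) - (νh / (1 - νh)) ^ 2) / 2 - 576 * ((4 : ℕ) : ℝ) * (αh ^ 2 * Real.exp (2 * αh))) / (Fintype.card n : ℝ) - 28 * ((4 : ℕ) : ℝ) * (ε + 7 * αh ^ 2)) →
    0 ≤ c₀ → c₀ ≤ A * ((ℓ : ℝ) + 1) ^ p → 0 ≤ c₁ → c₁ ≤ A * ((ℓ : ℝ) + 1) ^ p →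
    -- (CUBE): the printed first-order chart of [B11] Thm 1 (9) about every point, on the `(4ℓ+64)`-fold cover
    (∀ D : Site 4 → Fin 4 → (Matrix n n ℂ)ˣ, IsUnitaryCfg D → IsPeriodicCfg D ((N * (4 * ℓ + 64)) : ℤ) → SmallField D (4 * (Real.exp β - 1)) →
      ∀ (k : ℕ), ∀ U ∈ admissible (sfClass 4 2 (N * (4 * ℓ + 64)) ε) 2 (k + 1) D,
      (∀ φ : Site 4 → Fin 4 → Matrix n n ℂ, IsSkewDir φ → IsPeriodicDir φ (((N * (4 * ℓ + 64)) * 2 ^ (k + 1) : ℕ) : ℤ) → TangentIter 2 k U φ →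
        dAction U φ (perWin 4 ((N * (4 * ℓ + 64)) * 2 ^ (k + 1))) = 0) →
      ∀ r : ℝ, 0 ≤ r → r ≤ (1 / ((2 : ℕ) : ℝ) ^ 2 * ε) → SmallField U (r / (((2 : ℕ) : ℝ) ^ (k + 1)) ^ 2) →
      ∀ z : Site 4, ∃ (u₀ : Site 4 → (Matrix n n ℂ)ˣ) (A₀ : Site 4 → Fin 4 → Matrix n n ℂ), IsUnitarySite u₀ ∧
        (∀ (p : Site 4) (μ : Fin 4), (∀ i, |p i - z i| ≤ (((nbRad 4 2 + 2 * ℓ + 11) * 2 ^ (k + 1) : ℕ) : ℤ)) → gaugeAct u₀ U p μ = expUnit (A₀ p μ)) ∧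
        (∀ (p : Site 4) (μ : Fin 4), (∀ i, |p i - z i| ≤ (((nbRad 4 2 + 2 * ℓ + 11) * 2 ^ (k + 1) : ℕ) : ℤ)) → A₀ p μ ∈ skewAdjoint (Matrix n n ℂ)) ∧
        (∀ (p : Site 4) (μ : Fin 4), (∀ i, |p i - z i| ≤ (((nbRad 4 2 + 2 * ℓ + 11) * 2 ^ (k + 1) : ℕ) : ℤ)) →
          ‖A₀ p μ‖ ≤ c₀ * (r + 4 * (Real.exp β - 1) + ε) / ((2 : ℕ) : ℝ) ^ (k + 1)) ∧
        (∀ (p : Site 4) (μ τ : Fin 4), (∀ i, |p i - z i| ≤ (((nbRad 4 2 + 2 * ℓ + 11) * 2 ^ (k + 1) : ℕ) : ℤ)) →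
          (∀ i, |(p + e τ) i - z i| ≤ (((nbRad 4 2 + 2 * ℓ + 11) * 2 ^ (k + 1) : ℕ) : ℤ)) →
          ‖A₀ (p + e τ) μ - A₀ p μ‖ ≤ c₁ * (r + 4 * (Real.exp β - 1) + ε) / (((2 : ℕ) : ℝ) ^ (k + 1)) ^ 2)) →
    -- ROW NE3's PER-PAIR BINDER on the data class (F31's `hleaves`)
    (∀ D : Site 4 → Fin 4 → (Matrix n n ℂ)ˣ, IsUnitaryCfg D → IsPeriodicCfg D (N : ℤ) → SmallField D (4 * (Real.exp β - 1)) → ∀ (k : ℕ), ∀ Us ∈ admissible (sfClass 4 2 N ε) 2 (k + 1) D, SmallField Us ((1 / ((2 : ℕ) : ℝ) ^ 2 * ε / 2) / (((2 : ℕ) : ℝ) ^ (k + 1)) ^ 2) → (∀ φ : Site 4 → Fin 4 → Matrix n n ℂ, IsSkewDir φ → IsPeriodicDir φ ((N * 2 ^ (k + 1) : ℕ) : ℤ) → TangentIter 2 k Us φ → dAction Us φ (perWin 4 (N * 2 ^ (k + 1))) = 0) → ∀ U' ∈ admissible (sfClass 4 2 N ε) 2 (k + 1) D, ∃ (u : Site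 4 → (Matrix n n ℂ)ˣ) (X₀ : Site 4 → Fin 4 → Matrix n n ℂ) (α₀ : ℝ) (m : Site 4 → Fin 4 → ℝ) (C : ℝ), IsSkewDir X₀ ∧ (∀ (hWu : IsUnitaryCfg Us) (hx : 0 ≤ ε / (((2 : ℕ) : ℝ) ^ (k + 1)) ^ 2) (hs : LevelSmall 4 2 k (ε / (((2 : ℕ) : ℝ) ^ (k + 1)) ^ 2)) (hWx : SmallField Us (ε / (((2 : ℕ) : ℝ) ^ (k + 1)) ^ 2)) (hθ : cruxC 4 2 * ((((2 : ℕ) : ℝ) ^ (k + 1)) ^ 2 * (ε / (((2 : ℕ) : ℝ) ^ (k + 1)) ^ 2)) < 1) (hφ : IsSkewDir (dirIter 2 (k + 1) Us X₀)), ResidualSliceRepT 2 N (k + 1) Us U' u X₀ (rightInvW (by norm_num) k hWu hx hs hWx N hθ hφ) α₀) ∧ (∀ z κ, 0 ≤ m z κ) ∧ 0 ≤ C ∧ (((2 : ℕ) : ℝ) ^ (k + 1)) ^ 4 * ∑ z ∈ periodBox (d := 4) N, ∑ κ : Fin 4, m z κ ^ 2 ≤ C ^ 2 * dirSq X₀ (periodBox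 (d := 4) (N * 2 ^ (k + 1))) ∧ (∀ z ∈ periodBox (d := 4) N, ∀ κ : Fin 4, ‖dirIter 2 (k + 1) Us X₀ z κ‖ ≤ C₂ * (((2 : ℕ) : ℝ) ^ (k + 1) * m z κ) ^ 2) ∧ α₀ * ((2 : ℕ) : ℝ) ^ (k + 1) ≤ αh ∧ (∀ z κ, m z κ * ((2 : ℕ) : ℝ) ^ (k + 1) ≤ αh) ∧ C ≤ Ch) →
    ∃ δV : ℝ, 0 < δV ∧
      ∀ V ∈ {V : Site 4 → Fin 4 → (Matrix n n ℂ)ˣ | IsUnitaryCfg V ∧ IsPeriodicCfg V (N : ℤ) ∧ SmallField V δV},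
      ∀ k : ℕ, ∃ U : Site 4 → Fin 4 → (Matrix n n ℂ)ˣ, IsMinimiser 4 (sfClass 4 2 N ε) 2 N k V U ∧
        ∃ a : ℝ, 0 ≤ a ∧ a < ε / (((2 : ℕ) : ℝ) ^ k) ^ 2 ∧ SmallField U a := by
  obtain ⟨ℓ, hℓ1, ε₀, hε₀, H⟩ := hint_of_localChart_SU2_wide (n := n) hn (A := 2 * A) (by positivity) p
  refine ⟨ℓ, hℓ1, ε₀, hε₀, fun ε hε hεle => ?_⟩
  obtain ⟨β₀, hβ₀, H2⟩ := H ε hε hεle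
  refine ⟨β₀, hβ₀, ?_⟩
  intro β hβ hβle N _ C₂ αh Ch νh κh c₀ c₁ hN hC₂ hαh0 hαh1 hCh0 hνh hκh hν hline hc₀ hc₀b hc₁ hc₁b hcube hleaves
  have hpow : 0 ≤ A * ((ℓ : ℝ) + 1) ^ p := by positivity
  have hC₀b : c₀ ≤ 2 * A * ((ℓ : ℝ) + 1) ^ p := by linarith
  have hC₁ : 0 ≤ c₀ + c₁ := by positivity
  have hC₁b : c₀ + c₁ ≤ 2 * A * ((ℓ : ℝ) + 1) ^ p := by linarith
  have hchart := chart_of_cubeChart_SU2 (n := n) ℓ hN (Kc := 4 * ℓ + 64) le_rfl hε.le hβ.le hc₀ hc₁ hcube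
  exact H2 β hβ hβle N (4 * ℓ + 64) c₀ (c₀ + c₁) C₂ αh Ch νh κh hN (by omega)
    hC₂ hαh0 hαh1 hCh0 hνh hκh hν hline hc₀ hC₀b hC₁ hC₁b hchart hleaves

end

end Summit.QuantumFields.BalabanUV.T4Continuum.NE7HintOfCubeChartSU2
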